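import Summits.HodgeConjecture.HodgeConjecture.Theorems.F0P6cDictConstructorsStubs   -- ★ previous part of the same Lines workfile `F0_P6c_DictConstructors` (size-lint split ×3)
import HarnessLib

/-!
# `F0P6cDictConstructorsHead` — ★ RE-HOME of `Lines/F0_P6c_DictConstructors.lean`, PART 2 of 3 (size-lint split; cut at a declaration boundary).

See PART 1 `Theorems/F0P6cDictConstructorsStubs.lean` for the full re-home header and the original module docstring (verbatim there). Namespaces and sections KEPT
(re-opened below exactly as they stand at the cut, with their `open`∕`variable` lines replayed); code bytes = the workfile՚s, docstrings included; options preamble repeated from PART 1.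
HC_CM is proved only modulo the 7 printed citations (2 remaining: hLiu418 = stmt-HodgeConjecture-24832, h413 = stmt-HodgeConjecture-24833) until rung 0 closes; a re-home is count-neutral. -/

set_option autoImplicit false

noncomputable section

namespace Summit.HodgeConjecture.HodgeConjecture.Cruxes.HLiu418.F0P6cDictConstructors
set_option linter.dupNamespace false  -- `Summit.HodgeConjecture.HodgeConjecture.…` BY DESIGN (D-0017)
open CategoryTheory CategoryTheory.Limits AlgebraicGeometry MonoidalCategory CartesianMonoidalCategory
open NumberField IsDedekindDomain MulAction Polynomial
open scoped Matrix MonObj Obj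
open Literature.NumberTheory.GaloisRepresentations
open Literature.NumberTheory.Automorphic Literature.NumberTheory.Automorphic.UnitaryGroup
open Literature.AlgebraicGeometry.ShimuraVarieties.UnitaryCanonicalModel
open Literature.NumberTheory.Automorphic.Liu2021.AppendixC
open Literature.AlgebraicGeometry.Motives (AlgPoints SchemeOver specOver relFrobeniusOver frobeniusTwistOver)
open Literature.AlgebraicGeometry.GroupSchemes (eq_or_etale_of_isHopfIdeal_of_stable)
open Literature.AlgebraicGeometry.GroupSchemes.AffineGroupScheme (Alg quotIncl ptEquiv isoSpecOver ptEquiv_comp ptEquiv_quotIncl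
  exists_comp_quotIncl_eq_iff_le_ker Alg.comap_apply)
open Literature.AlgebraicGeometry.GroupSchemes.GroupSchemeKernel (ker kerι kerLift kerLift_ι)
open Summit.HodgeConjecture.HodgeConjecture.Cruxes.HLiu418.F0P6cIsogenyDictionary (PointDictionary)
universe v


/-! ### §3 HEAD — the dictionary from the binder block -/

section Head

variable (F : Type) [Field F] [NumberField F] [IsCMField F] (ι₁ : F →+* ℂ)
    (Jstar : Matrix (Fin 2) (Fin 2) F)
    (K₀ : C5.OpenCompactSubgroup ↥(finAdelic ↥(maximalRealSubfield F) F (IsCMField.complexConj F) 2 Jstar))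
    (S : RecordSystemGS F Jstar ι₁ K₀) (hU7ₛ : S.HeckeTranslateDefinedOver)
    (hJ : (Jstar.map (IsCMField.complexConj F))ᵀ = Jstar) (hJu : IsUnit Jstar)
    (w : HeightOneSpectrum (𝓞 F)) (hw : (IsCMField.complexConj F) • w ≠ w)
    (Kc : C5.SmallLevel K₀) (P : Type v) (Fr : P → P)
    (red : AlgPoints (S.M.obj Kc) (AlgebraicClosure (w.adicCompletion F)) → P)

/-- The Frobenius kernel as a MEMBER of the carrier (its admissibility by `isAdm_kerFI`). -/
def kerF {k₀ : Type} [Field k₀] [IsAlgClosed k₀] (p f : ℕ) [Fact p.Prime] [CharP k₀ p] [ExpChar k₀ p]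
    {σO : Type*} (G₀ : P → SchemeOver k₀) [∀ x, GrpObj (G₀ x)] [∀ x, IsCommMonObj (G₀ x)] [∀ x, IsAffine (G₀ x).left]
    [∀ x, IsFinite (G₀ x).hom] (β₀ : ∀ x, σO → (G₀ x ⟶ G₀ x)) (hβ₀ : ∀ x a, IsMonHom (β₀ x a))
    (hrkF : ∀ x, Module.finrank k₀ (Alg (G₀ x) ⧸ kerFI p f (G₀ x)) = p ^ f) (x : P) :
    AdmSub (G₀ x) (β₀ x) (p ^ f) :=
  ⟨kerFI p f (G₀ x), isAdm_kerFI p f (G₀ x) (β₀ x) (hβ₀ x) (hrkF x)⟩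

set_option maxHeartbeats 1600000 in
set_option synthInstance.maxHeartbeats 400000 in
/-- **HEAD — `heart_of_constructors`.**  From the binder block (CONSTRUCTOR-SKELETON v0 §2; every binder is a field of P6a՚s `ModuliDatum 𝔇`, a ★
theorem, or the (ii)-plumbing — see the K-DATA ∕ K-HYP tables there) to DICT՚s `PointDictionary … Kc P Fr red`, with `Sub x̄ := AdmSub (G₀ x̄) (β₀ x̄) q`,
`Line y := AdmSub (GΩ y) (βΩ y) q`, `kerF x̄ := ⟨kerFI p f (G₀ x̄), isAdm_kerFI …⟩`, `IsEtale H := IdealIsEtale _ H.1`.  Fields: (c1) = `hhecke`; (c2) =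
`hred_quotΩ`, `hred_translΩ` (★ `IntegralModel.geomReductionMap_comp_quot_eq` at ED. 4); (c3a) = ★ TRANSPORT `quot_kerF_of_cover` from `hHFimg`;
(c3b) = K3b ★ + K4 + D6 KILLS-FORM `hD6` + (c3a) at the quotient point; (c3c) = K3c ★ + K4 + `hD6` + (c3a) twice; (b) = ★ (K-b) via
`eq_kerFI_or_idealIsEtale_of_isAdm` (K0 ★, K1 ★); (b4′) = `hKb4`
(ED. 4 glue: (K-b4) CANONICAL-LINE B-p12 ★ p845304 + (E-b4′) ★ p845263 + (ii) A-p14 ★ p845336).  No `sorry`.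
[cite: Liu2021, Prop. D.8 p. 135, pp. 136–138] [cite: HarrisTaylorAMS2001, §III.4, pp. 108–110] -/
def heart_of_constructors
    -- the prime under `w` and `q = N w = p ^ f`; the special field `k₀` (ED. 4: `geomResidueField w`)
    {k₀ : Type} [Field k₀] [IsAlgClosed k₀] (p f : ℕ) [Fact p.Prime] [CharP k₀ p] [ExpChar k₀ p]
    -- K-DATA, level κ̄: the w-blocks `G₀ x̄ = 𝒢_x̄[ϖ]` with their `𝒪_F`-action (D2) and unit components, monogenic coordinates (D3 via P6d)
    {σO : Type*} (G₀ : P → SchemeOver k₀) [∀ x, GrpObj (G₀ x)] [∀ x, IsCommMonObj (G₀ x)] [∀ x, IsAffine (G₀ x).left]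
    [∀ x, IsFinite (G₀ x).hom] (β₀ : ∀ x, σO → (G₀ x ⟶ G₀ x)) (hβ₀ : ∀ x a, IsMonHom (β₀ x a))
    (U : P → SchemeOver k₀) [∀ x, GrpObj (U x)] [∀ x, IsAffine (U x).left] (jU : ∀ x, U x ⟶ G₀ x)
    (hU : ∀ x, IsMonHom (jU x) ∧ IsOpenImmersion (jU x).left ∧ IsClosedImmersion (jU x).left ∧ ConnectedSpace ↥(U x).left)
    (NU : P → ℕ) (θU : ∀ x, (k₀[X] ⧸ Ideal.span {(X : k₀[X]) ^ (p ^ NU x)}) ≃ₐ[k₀] Alg (U x))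
    -- K-HYP, level κ̄: ORD∕SS numerics of the w-block (D3 via P6d `OrdSSKernelsOnBT`, (FKw), ★ b1c): `F_q²` kills the unit component,
    -- ranks `q²`∕`q`, `#G₀ x̄ (κ̄) ∈ {1, q}`, the points are `𝒪_F`-simple
    (hFFU : ∀ x, jU x ≫ relFrobeniusOver p f (G₀ x) ≫ relFrobeniusOver p f (frobeniusTwistOver p f (G₀ x)) = 1)
    (hrkG : ∀ x, Module.finrank k₀ (Alg (G₀ x)) = p ^ f * p ^ f)
    (hrkF : ∀ x, Module.finrank k₀ (Alg (G₀ x) ⧸ kerFI p f (G₀ x)) = p ^ f)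
    (hpts : ∀ x, Nat.card (𝟙_ (SchemeOver k₀) ⟶ G₀ x) = 1 ∨ Nat.card (𝟙_ (SchemeOver k₀) ⟶ G₀ x) = p ^ f)
    (hsimple : ∀ x, ∀ Λ : Subgroup (𝟙_ (SchemeOver k₀) ⟶ G₀ x), (∀ a, ∀ g ∈ Λ, g ≫ β₀ x a ∈ Λ) → Λ = ⊥ ∨ Λ = ⊤)
    -- K-DATA, level Ω: the blocks at the generic points (étale; D2 at `ℓ_e y`)
    (GΩ : AlgPoints (S.M.obj Kc) (AlgebraicClosure (w.adicCompletion F)) → SchemeOver (AlgebraicClosure (w.adicCompletion F)))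
    [∀ y, GrpObj (GΩ y)] [∀ y, IsAffine (GΩ y).left] (βΩ : ∀ y, σO → (GΩ y ⟶ GΩ y))
    -- K-DATA: moduli quotients and translations at the two point levels (D4, D8), specialisation of lines ((ii) + (d5)(d6))
    (quotΩ : ∀ y, AdmSub (GΩ y) (βΩ y) (p ^ f) → AlgPoints (S.M.obj Kc) (AlgebraicClosure (w.adicCompletion F)))
    (translΩ : AlgPoints (S.M.obj Kc) (AlgebraicClosure (w.adicCompletion F)) → AlgPoints (S.M.obj Kc) (AlgebraicClosure (w.adicCompletion F)))
    (quot₀ : ∀ x, AdmSub (G₀ x) (β₀ x) (p ^ f) → P) (transl₀ : P → P)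
    (sp : ∀ y, AdmSub (GΩ y) (βΩ y) (p ^ f) → AdmSub (G₀ (red y)) (β₀ (red y)) (p ^ f))
    -- K-DATA: the `[ϖ]`-layer map of the quotient isogeny (D4 `isog`), killing its kernel; D6 in KILLS-FORM
    (isogW : ∀ x (H : AdmSub (G₀ x) (β₀ x) (p ^ f)), G₀ x ⟶ G₀ (quot₀ x H)) (hisogHom : ∀ x H, IsMonHom (isogW x H))
    (hisogKer : ∀ x (H : AdmSub (G₀ x) (β₀ x) (p ^ f)), quotIncl (G₀ x) H.1 ≫ isogW x H = 1)
    (hD6 : ∀ x (H : AdmSub (G₀ x) (β₀ x) (p ^ f)) (H' : AdmSub (G₀ (quot₀ x H)) (β₀ (quot₀ x H)) (p ^ f)),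
      H'.1 ≤ (RingHom.ker (isogW x H).left.appTop.hom : Ideal (Alg (G₀ (quot₀ x H)))) → quot₀ (quot₀ x H) H' = transl₀ x)
    -- SHEET TWIST (D10; ★ SHEET-COVER p845161, ★ FROB-SHEET p845200 (iii)): `act γ = θ(γ,1)_s`, transport of admissible ideals along the twist
    {Γ : Type*} (act : Γ → P → P)
    (smapI : ∀ (c : Γ) (x : P), Ideal (Alg (G₀ x)) → Ideal (Alg (G₀ (act c x))))
    (hsmapAdm : ∀ c x I, IsAdm (G₀ x) (β₀ x) (p ^ f) I → IsAdm (G₀ (act c x)) (β₀ (act c x)) (p ^ f) (smapI c x I))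
    (hsmapF : ∀ c x, smapI c x (kerFI p f (G₀ x)) = kerFI p f (G₀ (act c x)))
    (hquot : ∀ c x (H : AdmSub (G₀ x) (β₀ x) (p ^ f)), quot₀ (act c x) ⟨smapI c x H.1, hsmapAdm c x H.1 H.2⟩ = act c (quot₀ x H))
    (hFr : ∀ c x, Fr (act c x) = act c (Fr x))
    (hcover : ∀ x : P, ∃ (c : Γ) (y : AlgPoints (S.M.obj Kc) (AlgebraicClosure (w.adicCompletion F))), x = act c (red y))
    -- (c3a) ON THE IMAGE OF THE READING (P6a `stub_HFROB`, FORM-I): the quotient by the Frobenius kernel is the shadow Frobenius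
    (hHFimg : ∀ y, quot₀ (red y) (kerF P p f G₀ β₀ hβ₀ hrkF (red y)) = Fr (red y))
    -- (c2) (★ `IntegralModel.geomReductionMap_comp_quot_eq` at D5) and (b4′) (v2: CANONICAL-LINE + (ii)) as binders
    (hred_quotΩ : ∀ y L, red (quotΩ y L) = quot₀ (red y) (sp y L))
    (hred_translΩ : ∀ y, red (translΩ y) = transl₀ (red y))
    (hKb4 : ∀ y, (∃ H : AdmSub (G₀ (red y)) (β₀ (red y)) (p ^ f), IdealIsEtale (G₀ (red y)) H.1) →
      ∃ L₀ : AdmSub (GΩ y) (βΩ y) (p ^ f), sp y L₀ = kerF P p f G₀ β₀ hβ₀ hrkF (red y) ∧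
        ∀ L : AdmSub (GΩ y) (βΩ y) (p ^ f), sp y L = kerF P p f G₀ β₀ hβ₀ hrkF (red y) → L = L₀)
    -- (c1) HECKE = ISOGENY QUOTIENT (D7 verbatim)
    (hhecke : ∀ (N' : C5.SmallLevel K₀) (hN'Kc : N' ≤ Kc)
      (rc₁ : orbit (Kc.1.1 : Subgroup ↥(finAdelic ↥(maximalRealSubfield F) F (IsCMField.complexConj F) 2 Jstar))
           ((UnitaryGroup.heckeElementAt ↥(maximalRealSubfield F) F (IsCMField.complexConj F) 2 Jstar
               (⟨w, rfl⟩ : UnitaryGroup.PlacesOver F (w.under (𝓞 ↥(maximalRealSubfield F))))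
               (IsCMField.complexConj_ne_one F) hJ hw (UnitaryGroup.isUnit_placeForm Jstar hJu w) (HeckeCharacter.uniformizer F w) 1 :
             ↥(finAdelic ↥(maximalRealSubfield F) F (IsCMField.complexConj F) 2 Jstar)) :
             ↥(finAdelic ↥(maximalRealSubfield F) F (IsCMField.complexConj F) 2 Jstar) ⧸
               (Kc.1.1 : Subgroup ↥(finAdelic ↥(maximalRealSubfield F) F (IsCMField.complexConj F) 2 Jstar))) →
         ↥(finAdelic ↥(maximalRealSubfield F) F (IsCMField.complexConj F) 2 Jstar)),
      (∀ β, ((rc₁ β : ↥(finAdelic ↥(maximalRealSubfield F) F (IsCMField.complexConj F) 2 Jstar)) :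
          ↥(finAdelic ↥(maximalRealSubfield F) F (IsCMField.complexConj F) 2 Jstar) ⧸
            (Kc.1.1 : Subgroup ↥(finAdelic ↥(maximalRealSubfield F) F (IsCMField.complexConj F) 2 Jstar))) = β.1) →
      ∀ (hrcN₁ : ∀ β, C5.HeckeLE (rc₁ β) N' Kc)
        (rc₂ : orbit (Kc.1.1 : Subgroup ↥(finAdelic ↥(maximalRealSubfield F) F (IsCMField.complexConj F) 2 Jstar))
           ((UnitaryGroup.heckeElementAt ↥(maximalRealSubfield F) F (IsCMField.complexConj F) 2 Jstar
               (⟨w, rfl⟩ : UnitaryGroup.PlacesOver F (w.under (𝓞 ↥(maximalRealSubfield F))))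
               (IsCMField.complexConj_ne_one F) hJ hw (UnitaryGroup.isUnit_placeForm Jstar hJu w) (HeckeCharacter.uniformizer F w) 2 :
             ↥(finAdelic ↥(maximalRealSubfield F) F (IsCMField.complexConj F) 2 Jstar)) :
             ↥(finAdelic ↥(maximalRealSubfield F) F (IsCMField.complexConj F) 2 Jstar) ⧸
               (Kc.1.1 : Subgroup ↥(finAdelic ↥(maximalRealSubfield F) F (IsCMField.complexConj F) 2 Jstar))) →
         ↥(finAdelic ↥(maximalRealSubfield F) F (IsCMField.complexConj F) 2 Jstar)),
      (∀ β, ((rc₂ β : ↥(finAdelic ↥(maximalRealSubfield F) F (IsCMField.complexConj F) 2 Jstar)) :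
          ↥(finAdelic ↥(maximalRealSubfield F) F (IsCMField.complexConj F) 2 Jstar) ⧸
            (Kc.1.1 : Subgroup ↥(finAdelic ↥(maximalRealSubfield F) F (IsCMField.complexConj F) 2 Jstar))) = β.1) →
      ∀ (hrcN₂ : ∀ β, C5.HeckeLE (rc₂ β) N' Kc),
      ∀ x' : AlgPoints (S.M.obj N') (AlgebraicClosure (w.adicCompletion F)),
        ∃ e : (orbit (Kc.1.1 : Subgroup ↥(finAdelic ↥(maximalRealSubfield F) F (IsCMField.complexConj F) 2 Jstar))
           ((UnitaryGroup.heckeElementAt ↥(maximalRealSubfield F) F (IsCMField.complexConj F) 2 Jstar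
               (⟨w, rfl⟩ : UnitaryGroup.PlacesOver F (w.under (𝓞 ↥(maximalRealSubfield F))))
               (IsCMField.complexConj_ne_one F) hJ hw (UnitaryGroup.isUnit_placeForm Jstar hJu w) (HeckeCharacter.uniformizer F w) 1 :
             ↥(finAdelic ↥(maximalRealSubfield F) F (IsCMField.complexConj F) 2 Jstar)) :
             ↥(finAdelic ↥(maximalRealSubfield F) F (IsCMField.complexConj F) 2 Jstar) ⧸
               (Kc.1.1 : Subgroup ↥(finAdelic ↥(maximalRealSubfield F) F (IsCMField.complexConj F) 2 Jstar)))) ≃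
            AdmSub (GΩ (AlgPoints.map (S.M.map (homOfLE hN'Kc)) x')) (βΩ (AlgPoints.map (S.M.map (homOfLE hN'Kc)) x')) (p ^ f),
          (∀ β, AlgPoints.map (recordHeckeTranslateGS S hU7ₛ (rc₁ β) N' Kc (hrcN₁ β)) x' =
              quotΩ (AlgPoints.map (S.M.map (homOfLE hN'Kc)) x') (e β)) ∧
          ∀ β₂, AlgPoints.map (recordHeckeTranslateGS S hU7ₛ (rc₂ β₂) N' Kc (hrcN₂ β₂)) x' =
              translΩ (AlgPoints.map (S.M.map (homOfLE hN'Kc)) x')) :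
    PointDictionary.{0, v} F ι₁ Jstar K₀ S hU7ₛ hJ hJu w hw Kc P Fr red := by
  -- (c3a) everywhere, by TRANSPORT from the image of the reading
  have K3a : ∀ x, quot₀ x (kerF P p f G₀ β₀ hβ₀ hrkF x) = Fr x := by
    refine Literature.AlgebraicGeometry.Motives.SheetTransport.quot_kerF_of_cover act red
      (fun c x H => ⟨smapI c x H.1, hsmapAdm c x H.1 H.2⟩) hcover Fr hFr (kerF P p f G₀ β₀ hβ₀ hrkF) (fun c x => ?_) quot₀ hquot hHFimg
    exact Subtype.ext (hsmapF c x).symm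
  refine
    { Line := fun y => AdmSub (GΩ y) (βΩ y) (p ^ f)
      Sub := fun x => AdmSub (G₀ x) (β₀ x) (p ^ f)
      kerF := kerF P p f G₀ β₀ hβ₀ hrkF
      IsEtale := fun {x} H => IdealIsEtale (G₀ x) H.1
      quotΩ := quotΩ
      translΩ := translΩ
      quot := quot₀
      transl := transl₀
      sp := sp
      hecke := hhecke
      red_quotΩ := hred_quotΩ
      red_translΩ := hred_translΩ
      quot_kerF := K3a
      frob_quot_of_isEtale := fun x H hH => ?_
      frob_frob_of_forall_not_isEtale := fun x hx => ?_
      eq_kerF_or_isEtale := fun x H => ?_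
      canonicalLine := hKb4 }
  · -- (c3b): `Fr (quot x H) = quot x′ (kerF x′)` ((c3a) at `x′ := quot x H`) `= transl x` (D6 KILLS-FORM, the kill by K3b ★)
    haveI := hisogHom x H
    have hle := kerFI_le_ker_of_comp_relFrobeniusOver_eq_one p f (isogW x H)
      (comp_relFrobeniusOver_eq_one_of_isEtale p f (G₀ x) (G₀ (quot₀ x H)) (β₀ x) (U x) (jU x) (hU x) (hrkG x) (hrkF x)
        (isogW x H) H.1 H.2 hH (hisogKer x H))
    have h6 := hD6 x H (kerF P p f G₀ β₀ hβ₀ hrkF (quot₀ x H)) hle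
    rw [K3a (quot₀ x H)] at h6
    exact h6
  · -- (c3c): `Fr (Fr x) = Fr (quot x (kerF x)) = quot x′ (kerF x′) = transl x` (kill by K3c ★ p845505)
    haveI := hisogHom x (kerF P p f G₀ β₀ hβ₀ hrkF x)
    have hle := kerFI_le_ker_of_comp_relFrobeniusOver_eq_one p f (isogW x (kerF P p f G₀ β₀ hβ₀ hrkF x))
      (comp_relFrobeniusOver_eq_one_of_forall_not_isEtale p f (G₀ x) (G₀ (quot₀ x (kerF P p f G₀ β₀ hβ₀ hrkF x))) (β₀ x)
        (U x) (jU x) (hU x) (hFFU x) (hpts x) (fun I hI hIet => hx ⟨I, hI⟩ hIet) (isogW x (kerF P p f G₀ β₀ hβ₀ hrkF x))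
        (hisogKer x (kerF P p f G₀ β₀ hβ₀ hrkF x)))
    have h6 := hD6 x (kerF P p f G₀ β₀ hβ₀ hrkF x) (kerF P p f G₀ β₀ hβ₀ hrkF (quot₀ x (kerF P p f G₀ β₀ hβ₀ hrkF x))) hle
    rw [K3a (quot₀ x (kerF P p f G₀ β₀ hβ₀ hrkF x)), K3a x] at h6
    exact h6
  · -- (b): the dichotomy of admissible ideals
    rcases eq_kerFI_or_idealIsEtale_of_isAdm p f (G₀ x) (β₀ x) (hβ₀ x) (U x) (jU x) (hU x) (NU x) (θU x) (hrkF x) (hpts x) (hsimple x)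
      H.1 H.2 with h | h
    · exact Or.inl (Subtype.ext h)
    · exact Or.inr h

end Head

/-! ### §4 HEAD ON GIVEN CARRIERS — the dictionary on ABSTRACT carriers `Line`, `Sub` identified downstairs with the admissible ideals (ED. 2) -/

section HeadOnCarriers

universe u' v'

variable (F : Type) [Field F] [NumberField F] [IsCMField F] (ι₁ : F →+* ℂ)
    (Jstar : Matrix (Fin 2) (Fin 2) F)
    (K₀ : C5.OpenCompactSubgroup ↥(finAdelic ↥(maximalRealSubfield F) F (IsCMField.complexConj F) 2 Jstar))
    (S : RecordSystemGS F Jstar ι₁ K₀) (hU7ₛ : S.HeckeTranslateDefinedOver)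
    (hJ : (Jstar.map (IsCMField.complexConj F))ᵀ = Jstar) (hJu : IsUnit Jstar)
    (w : HeightOneSpectrum (𝓞 F)) (hw : (IsCMField.complexConj F) • w ≠ w)
    (Kc : C5.SmallLevel K₀) (P : Type v') (Fr : P → P)
    (red : AlgPoints (S.M.obj Kc) (AlgebraicClosure (w.adicCompletion F)) → P)

set_option maxHeartbeats 1600000 in
set_option synthInstance.maxHeartbeats 400000 in
/-- **HEAD ON GIVEN CARRIERS — `heart_of_carriers`** (ED. 2; the ED.-4 junction after P6a D-4 «D3 DOWNSTAIRS», LEAD M-17c).  The same dictionary as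
`heart_of_constructors`, but built ON THE CARRIERS P6a՚s `ModuliDatum 𝔇` already has: an ABSTRACT `Line y` (upstairs nothing but a type family is
used — `𝔇.Line`, pinned by `lineSub`) and an ABSTRACT `Sub x̄` with its `kerF`, `IsEtale`, IDENTIFIED DOWNSTAIRS with the admissible ideals of the
w-block by `subEquiv x̄ : Sub x̄ ≃ AdmSub (G₀ x̄) (β₀ x̄) q` (`𝔇.subEquiv`), `hkerF` (`𝔇.kerF_spec`: the Frobenius kernel goes to `kerFI`) and `hIsEtale`
(`𝔇.isEtale_spec`).  Every other binder is then a FIELD of `𝔇` VERBATIM (`quotΩ translΩ quot transl sp hecke red_quotΩ red_translΩ`, TWIST `smap`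
`smap_kerF` `quot_smap` with `act γ := actOf S Kc 𝓜 w θ γ`), ★ FROB-SHEET (iii) `hFr`, ★ SHEET-COVER `hcover`, `stub_HFROB` FORM-I `hHFimg`, the
isogeny rows `isogW hisogHom hisogKer hD6` (ideal currency through `subEquiv`), (b4′) `hKb4`, and the K-rows of P6b `blockNumerics_of_line` — so that
ED. 4՚s `stub_HEART` is ONE term `⟨heart_of_carriers … 𝔇.Line 𝔇.Sub 𝔇.subEquiv 𝔇.kerF 𝔇.kerF_spec (fun H => 𝔇.IsEtale H) 𝔇.isEtale_spec 𝔇.quotΩ …⟩`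
with NO transport of `hecke` along carrier equivalences.  Output carriers: `Line := Line`, `Sub := Sub`, `kerF := kerF`, `IsEtale := IsEtale`.
Proof = §3՚s: (c3a) ★ TRANSPORT `SheetTransport.quot_kerF_of_cover` (abstract `smap`), (c3b) K3b ★ + K4 + `hD6`, (c3c) K3c ★ + K4 + `hD6`, (b) ★ (K-b)
pulled back along `subEquiv`.  No `sorry`; axioms = the Lean trio.
[cite: Liu2021, Prop. D.8 p. 135, pp. 136–138] [cite: HarrisTaylorAMS2001, §III.4, pp. 108–110] [cite: Tate1997FiniteFlatGroupSchemes, (3.7)] -/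
def heart_of_carriers
    -- the prime under `w` and `q = N w = p ^ f`; the special field `k₀` (ED. 4: `geomResidueField w`)
    {k₀ : Type} [Field k₀] [IsAlgClosed k₀] (p f : ℕ) [Fact p.Prime] [CharP k₀ p] [ExpChar k₀ p]
    -- K-DATA, level κ̄: the w-blocks `G₀ x̄ = 𝒢_x̄[ϖ]` with their `𝒪_F`-action and unit components, monogenic coordinates (P6b `blockNumerics_of_line`)
    {σO : Type*} (G₀ : P → SchemeOver k₀) [∀ x, GrpObj (G₀ x)] [∀ x, IsCommMonObj (G₀ x)] [∀ x, IsAffine (G₀ x).left]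
    [∀ x, IsFinite (G₀ x).hom] (β₀ : ∀ x, σO → (G₀ x ⟶ G₀ x)) (hβ₀ : ∀ x a, IsMonHom (β₀ x a))
    (U : P → SchemeOver k₀) [∀ x, GrpObj (U x)] [∀ x, IsAffine (U x).left] (jU : ∀ x, U x ⟶ G₀ x)
    (hU : ∀ x, IsMonHom (jU x) ∧ IsOpenImmersion (jU x).left ∧ IsClosedImmersion (jU x).left ∧ ConnectedSpace ↥(U x).left)
    (NU : P → ℕ) (θU : ∀ x, (k₀[X] ⧸ Ideal.span {(X : k₀[X]) ^ (p ^ NU x)}) ≃ₐ[k₀] Alg (U x))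
    -- K-HYP, level κ̄: ORD∕SS numerics of the w-block (P6b): `F_q²` kills the unit component, ranks `q²`∕`q`, `#G₀ x̄ (κ̄) ∈ {1, q}`, `𝒪_F`-simple points
    (hFFU : ∀ x, jU x ≫ relFrobeniusOver p f (G₀ x) ≫ relFrobeniusOver p f (frobeniusTwistOver p f (G₀ x)) = 1)
    (hrkG : ∀ x, Module.finrank k₀ (Alg (G₀ x)) = p ^ f * p ^ f)
    (hrkF : ∀ x, Module.finrank k₀ (Alg (G₀ x) ⧸ kerFI p f (G₀ x)) = p ^ f)
    (hpts : ∀ x, Nat.card (𝟙_ (SchemeOver k₀) ⟶ G₀ x) = 1 ∨ Nat.card (𝟙_ (SchemeOver k₀) ⟶ G₀ x) = p ^ f)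
    (hsimple : ∀ x, ∀ Λ : Subgroup (𝟙_ (SchemeOver k₀) ⟶ G₀ x), (∀ a, ∀ g ∈ Λ, g ≫ β₀ x a ∈ Λ) → Λ = ⊥ ∨ Λ = ⊤)
    -- CARRIERS (P6a `ModuliDatum` fields `Line Sub kerF IsEtale`) + the DOWNSTAIRS IDENTIFICATION (D-4: `subEquiv`, `kerF_spec`, `isEtale_spec`)
    (Line : AlgPoints (S.M.obj Kc) (AlgebraicClosure (w.adicCompletion F)) → Type u') (Sub : P → Type u')
    (subEquiv : ∀ x, Sub x ≃ AdmSub (G₀ x) (β₀ x) (p ^ f))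
    (kerF : ∀ x, Sub x) (hkerF : ∀ x, (subEquiv x (kerF x)).1 = kerFI p f (G₀ x))
    (IsEtale : ∀ {x : P}, Sub x → Prop) (hIsEtale : ∀ x (H : Sub x), IsEtale H ↔ IdealIsEtale (G₀ x) (subEquiv x H).1)
    -- K-DATA: moduli quotients and translations at the two point levels, specialisation of lines (fields of `𝔇` verbatim)
    (quotΩ : ∀ y, Line y → AlgPoints (S.M.obj Kc) (AlgebraicClosure (w.adicCompletion F)))
    (translΩ : AlgPoints (S.M.obj Kc) (AlgebraicClosure (w.adicCompletion F)) → AlgPoints (S.M.obj Kc) (AlgebraicClosure (w.adicCompletion F)))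
    (quot₀ : ∀ x, Sub x → P) (transl₀ : P → P)
    (sp : ∀ y, Line y → Sub (red y))
    -- K-DATA: the `[ϖ]`-layer map of the quotient isogeny killing its kernel; D6 in KILLS-FORM (ideal currency through `subEquiv`)
    (isogW : ∀ x (H : Sub x), G₀ x ⟶ G₀ (quot₀ x H)) (hisogHom : ∀ x H, IsMonHom (isogW x H))
    (hisogKer : ∀ x (H : Sub x), quotIncl (G₀ x) (subEquiv x H).1 ≫ isogW x H = 1)
    (hD6 : ∀ x (H : Sub x) (H' : Sub (quot₀ x H)),
      (subEquiv (quot₀ x H) H').1 ≤ (RingHom.ker (isogW x H).left.appTop.hom : Ideal (Alg (G₀ (quot₀ x H)))) →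
        quot₀ (quot₀ x H) H' = transl₀ x)
    -- SHEET TWIST in `𝔇`՚s abstract form (`smap`, `smap_kerF`, `quot_smap`; ★ FROB-SHEET p845200 (iii) `hFr`; ★ SHEET-COVER p845161 `hcover`)
    {Γ : Type*} (act : Γ → P → P)
    (smap : ∀ (c : Γ) (x : P), Sub x → Sub (act c x))
    (hsmapF : ∀ c x, smap c x (kerF x) = kerF (act c x))
    (hquot : ∀ c x (H : Sub x), quot₀ (act c x) (smap c x H) = act c (quot₀ x H))
    (hFr : ∀ c x, Fr (act c x) = act c (Fr x))
    (hcover : ∀ x : P, ∃ (c : Γ) (y : AlgPoints (S.M.obj Kc) (AlgebraicClosure (w.adicCompletion F))), x = act c (red y))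
    -- (c3a) ON THE IMAGE OF THE READING (P6a `stub_HFROB`, FORM-I)
    (hHFimg : ∀ y, quot₀ (red y) (kerF (red y)) = Fr (red y))
    -- (c2) and (b4′) as binders (fields `red_quotΩ`, `red_translΩ` of `𝔇`; CANONICAL LINE via ★ `CanonicalLine.existsUnique_admK_spI_eq_kerFI`)
    (hred_quotΩ : ∀ y L, red (quotΩ y L) = quot₀ (red y) (sp y L))
    (hred_translΩ : ∀ y, red (translΩ y) = transl₀ (red y))
    (hKb4 : ∀ y, (∃ H : Sub (red y), IsEtale H) →
      ∃ L₀ : Line y, sp y L₀ = kerF (red y) ∧ ∀ L : Line y, sp y L = kerF (red y) → L = L₀)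
    -- (c1) HECKE = ISOGENY QUOTIENT (`𝔇.hecke` verbatim)
    (hhecke : ∀ (N' : C5.SmallLevel K₀) (hN'Kc : N' ≤ Kc)
      (rc₁ : orbit (Kc.1.1 : Subgroup ↥(finAdelic ↥(maximalRealSubfield F) F (IsCMField.complexConj F) 2 Jstar))
           ((UnitaryGroup.heckeElementAt ↥(maximalRealSubfield F) F (IsCMField.complexConj F) 2 Jstar
               (⟨w, rfl⟩ : UnitaryGroup.PlacesOver F (w.under (𝓞 ↥(maximalRealSubfield F))))
               (IsCMField.complexConj_ne_one F) hJ hw (UnitaryGroup.isUnit_placeForm Jstar hJu w) (HeckeCharacter.uniformizer F w) 1 :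
             ↥(finAdelic ↥(maximalRealSubfield F) F (IsCMField.complexConj F) 2 Jstar)) :
             ↥(finAdelic ↥(maximalRealSubfield F) F (IsCMField.complexConj F) 2 Jstar) ⧸
               (Kc.1.1 : Subgroup ↥(finAdelic ↥(maximalRealSubfield F) F (IsCMField.complexConj F) 2 Jstar))) →
         ↥(finAdelic ↥(maximalRealSubfield F) F (IsCMField.complexConj F) 2 Jstar)),
      (∀ β, ((rc₁ β : ↥(finAdelic ↥(maximalRealSubfield F) F (IsCMField.complexConj F) 2 Jstar)) :
          ↥(finAdelic ↥(maximalRealSubfield F) F (IsCMField.complexConj F) 2 Jstar) ⧸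
            (Kc.1.1 : Subgroup ↥(finAdelic ↥(maximalRealSubfield F) F (IsCMField.complexConj F) 2 Jstar))) = β.1) →
      ∀ (hrcN₁ : ∀ β, C5.HeckeLE (rc₁ β) N' Kc)
        (rc₂ : orbit (Kc.1.1 : Subgroup ↥(finAdelic ↥(maximalRealSubfield F) F (IsCMField.complexConj F) 2 Jstar))
           ((UnitaryGroup.heckeElementAt ↥(maximalRealSubfield F) F (IsCMField.complexConj F) 2 Jstar
               (⟨w, rfl⟩ : UnitaryGroup.PlacesOver F (w.under (𝓞 ↥(maximalRealSubfield F))))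
               (IsCMField.complexConj_ne_one F) hJ hw (UnitaryGroup.isUnit_placeForm Jstar hJu w) (HeckeCharacter.uniformizer F w) 2 :
             ↥(finAdelic ↥(maximalRealSubfield F) F (IsCMField.complexConj F) 2 Jstar)) :
             ↥(finAdelic ↥(maximalRealSubfield F) F (IsCMField.complexConj F) 2 Jstar) ⧸
               (Kc.1.1 : Subgroup ↥(finAdelic ↥(maximalRealSubfield F) F (IsCMField.complexConj F) 2 Jstar))) →
         ↥(finAdelic ↥(maximalRealSubfield F) F (IsCMField.complexConj F) 2 Jstar)),
      (∀ β, ((rc₂ β : ↥(finAdelic ↥(maximalRealSubfield F) F (IsCMField.complexConj F) 2 Jstar)) :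
          ↥(finAdelic ↥(maximalRealSubfield F) F (IsCMField.complexConj F) 2 Jstar) ⧸
            (Kc.1.1 : Subgroup ↥(finAdelic ↥(maximalRealSubfield F) F (IsCMField.complexConj F) 2 Jstar))) = β.1) →
      ∀ (hrcN₂ : ∀ β, C5.HeckeLE (rc₂ β) N' Kc),
      ∀ x' : AlgPoints (S.M.obj N') (AlgebraicClosure (w.adicCompletion F)),
        ∃ e : (orbit (Kc.1.1 : Subgroup ↥(finAdelic ↥(maximalRealSubfield F) F (IsCMField.complexConj F) 2 Jstar))
           ((UnitaryGroup.heckeElementAt ↥(maximalRealSubfield F) F (IsCMField.complexConj F) 2 Jstar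
               (⟨w, rfl⟩ : UnitaryGroup.PlacesOver F (w.under (𝓞 ↥(maximalRealSubfield F))))
               (IsCMField.complexConj_ne_one F) hJ hw (UnitaryGroup.isUnit_placeForm Jstar hJu w) (HeckeCharacter.uniformizer F w) 1 :
             ↥(finAdelic ↥(maximalRealSubfield F) F (IsCMField.complexConj F) 2 Jstar)) :
             ↥(finAdelic ↥(maximalRealSubfield F) F (IsCMField.complexConj F) 2 Jstar) ⧸
               (Kc.1.1 : Subgroup ↥(finAdelic ↥(maximalRealSubfield F) F (IsCMField.complexConj F) 2 Jstar)))) ≃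
            Line (AlgPoints.map (S.M.map (homOfLE hN'Kc)) x'),
          (∀ β, AlgPoints.map (recordHeckeTranslateGS S hU7ₛ (rc₁ β) N' Kc (hrcN₁ β)) x' =
              quotΩ (AlgPoints.map (S.M.map (homOfLE hN'Kc)) x') (e β)) ∧
          ∀ β₂, AlgPoints.map (recordHeckeTranslateGS S hU7ₛ (rc₂ β₂) N' Kc (hrcN₂ β₂)) x' =
              translΩ (AlgPoints.map (S.M.map (homOfLE hN'Kc)) x')) :
    PointDictionary.{u', v'} F ι₁ Jstar K₀ S hU7ₛ hJ hJu w hw Kc P Fr red := by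
  -- the Frobenius kernel IS the admissible Frobenius-kernel ideal under `subEquiv` (as a member)
  have hK : ∀ x, subEquiv x (kerF x) = ⟨kerFI p f (G₀ x), isAdm_kerFI p f (G₀ x) (β₀ x) (hβ₀ x) (hrkF x)⟩ :=
    fun x => Subtype.ext (hkerF x)
  -- (c3a) everywhere, by TRANSPORT from the image of the reading (abstract `smap`)
  have K3a : ∀ x, quot₀ x (kerF x) = Fr x :=
    Literature.AlgebraicGeometry.Motives.SheetTransport.quot_kerF_of_cover act red smap hcover Fr hFr kerF
      (fun c x => (hsmapF c x).symm) quot₀ hquot hHFimg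
  refine
    { Line := Line
      Sub := Sub
      kerF := kerF
      IsEtale := fun {x} H => IsEtale H
      quotΩ := quotΩ
      translΩ := translΩ
      quot := quot₀
      transl := transl₀
      sp := sp
      hecke := hhecke
      red_quotΩ := hred_quotΩ
      red_translΩ := hred_translΩ
      quot_kerF := K3a
      frob_quot_of_isEtale := fun x H hH => ?_
      frob_frob_of_forall_not_isEtale := fun x hx => ?_
      eq_kerF_or_isEtale := fun x H => ?_
      canonicalLine := hKb4 }
  · -- (c3b): `Fr (quot x H) = quot x′ (kerF x′)` ((c3a) at `x′ := quot x H`) `= transl x` (D6 KILLS-FORM, the kill by K3b ★ on the ideal of `H`)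
    haveI := hisogHom x H
    have hle := kerFI_le_ker_of_comp_relFrobeniusOver_eq_one p f (isogW x H)
      (comp_relFrobeniusOver_eq_one_of_isEtale p f (G₀ x) (G₀ (quot₀ x H)) (β₀ x) (U x) (jU x) (hU x) (hrkG x) (hrkF x)
        (isogW x H) (subEquiv x H).1 (subEquiv x H).2 ((hIsEtale x H).mp hH) (hisogKer x H))
    have h6 := hD6 x H (kerF (quot₀ x H)) (by rw [hkerF]; exact hle)
    rw [K3a (quot₀ x H)] at h6
    exact h6
  · -- (c3c): `Fr (Fr x) = Fr (quot x (kerF x)) = quot x′ (kerF x′) = transl x` (kill by K3c ★: no étale admissible ideal, read through `subEquiv`)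
    have hnone : ∀ I : Ideal (Alg (G₀ x)), IsAdm (G₀ x) (β₀ x) (p ^ f) I → ¬ IdealIsEtale (G₀ x) I := fun I hI hIet =>
      hx ((subEquiv x).symm ⟨I, hI⟩) ((hIsEtale x _).mpr (by rw [Equiv.apply_symm_apply]; exact hIet))
    haveI := hisogHom x (kerF x)
    have hφ : quotIncl (G₀ x) (kerFI p f (G₀ x)) ≫ isogW x (kerF x) = 1 := by
      have h := hisogKer x (kerF x)
      rw [hK x] at h
      exact h
    have hle := kerFI_le_ker_of_comp_relFrobeniusOver_eq_one p f (isogW x (kerF x))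
      (comp_relFrobeniusOver_eq_one_of_forall_not_isEtale p f (G₀ x) (G₀ (quot₀ x (kerF x))) (β₀ x) (U x) (jU x) (hU x)
        (hFFU x) (hpts x) hnone (isogW x (kerF x)) hφ)
    have h6 := hD6 x (kerF x) (kerF (quot₀ x (kerF x))) (by rw [hkerF]; exact hle)
    rw [K3a (quot₀ x (kerF x)), K3a x] at h6
    exact h6
  · -- (b): the dichotomy of admissible ideals, pulled back along `subEquiv`
    rcases eq_kerFI_or_idealIsEtale_of_isAdm p f (G₀ x) (β₀ x) (hβ₀ x) (U x) (jU x) (hU x) (NU x) (θU x) (hrkF x) (hpts x)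
      (hsimple x) (subEquiv x H).1 (subEquiv x H).2 with h | h
    · refine Or.inl ((subEquiv x).injective ?_)
      rw [hK x]
      exact Subtype.ext h
    · exact Or.inr ((hIsEtale x H).mpr h)

end HeadOnCarriers

end Summit.HodgeConjecture.HodgeConjecture.Cruxes.HLiu418.F0P6cDictConstructors
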